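import Literature.MathematicalPhysics.QuantumFieldTheory.Balaban1983to89.T4ApexTelescope
import Literature.MathematicalPhysics.QuantumFieldTheory.Balaban1983to89.T4SummableDefect

/-!
# RUNG (B)+1: THE OBSERVABLE-LEVEL TELESCOPING LANE'S **WEAKEST** HYPOTHESIS SHAPES — the summable envelope of the one-run
# defects plus the mid-level limits at every fixed distance (`T4SummableDefect`, generation 8 of the producing lineage), and the
# supplier-currency bundle (summable exterior-covariance budgets + the good/bad datum along a run ladder) — UNDER THE TARGETS'
# PREFIX, BOUND TO THE FOUR TARGETS AND TO THE RESTRICTED `SU(N)` HEADLINES; and (§5) THE SERIES FORM OF THE CONTINUUM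
# EXPECTATION with the LOCATED STRICTNESS of the lane's wall
# (apex lineage `T4Continuum` → `T4Apex` → … → `T4ApexPrinted` → `T4ApexTelescope` → this file, joined with the producing lineage's
# leaf `T4SummableDefect`; ADDITIVE — a new leaf, no existing module is modified, no importer; cell `pub-balaban`, scoping sub-cell
# `t4`, fan-out lineage t4-ne1p-p3 = PROVER seat P3 of the spine estimate NE1′, assigned technique «observable-level telescoping»,
# generation 18; journal row T4-O3.E-NE1′-PROVE-P3k*, written under a YIELD CLAUSE to the apex lineage's owner t4-lean / t4-carver)

STATEMENTS AND QUANTIFIER BOOKKEEPING ONLY in §1–§4: every theorem there is a short composition of theorems already in the tree;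
§5 is real analysis of the cell's real-number sequences (Tannery's theorem from Mathlib, `tendsto_tsum_of_dominated_convergence`,
on the telescoping identity `expectAt_eq_finalExpect_add_sum`).  Nothing analytic about T. Bałaban's densities is proved or
asserted; every declaration is tagged [folklore]; sorry-free.

HONEST FRAMING.  Finite four-torus, rung (B)+1 only: the `ε → 0` limit of the joint expectations of unit-scale averaged
gauge-invariant Wilson-loop variables on ONE torus of fixed physical size, along the Wilson schemes `D.scheme g₀` of a datum of
Bałaban type `D : T4Continuum.FiniteEpsData F G`, UNDER (B) = [Balaban1989LargeFieldII] Thm 1 (pinned, `B16.EndStatementBPrinted D.C`)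
and a β-function hypothesis (`BetaPertHyp D.βfun`, resp. the print-faithful `DagBinding.EndpointExistence D.C.toB12`), both carried
INSIDE every target as antecedents of the prefix `FiniteEpsData.UnderHypotheses` and never discharged.  NOT infinite volume, NOT a
mass gap, NOT non-triviality, NOT local gauge-invariant fields, NOT the Clay problem.  The four targets stay OPEN `Prop`s; value =
typed skeleton and census by name; NOT summit progress.

CITATION HEADER (lean-in-tree rule).  No page of T. Bałaban's series (CMP 1983–89) or of any other source was newly read for this
module and no sentence is attributed to print here.  The framing sentence «deserve detailed analysis and further publication»
([Balaban1989LargeFieldII] p. 356, of the loop-variable expectations) is the one carried verbatim by the certified headers of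
`…Missing` §2 / `…T4Continuum`, not re-quoted as new.  The hypothesis SHAPES consumed are re-used BY NAME with their own modules'
provenance: `T4SummableDefect.UniformSummableDefect` / `MidLimits` / `SummableCovDefect` / `SummableDefectBudget` (generation 8),
`T4ExteriorCovariance.UniformCovDefect` (generation 7), `T4ObservableTelescopeTwoRun.UniformGeomDefect` / `MidDiscrepancyRate` /
`MidGoodBadRate` / `RunLadder` / `LadderGoodBadRate` / `MidRateTelescopeData` (generations 2–3), `T4ApexTelescope.GoodBadTelescopeData` /
`CanonicalGoodBadTelescopeData` / the `…Under` shapes (t4-lean gens 14–15), `T4RunLadder.runLadder` (t4-lean gen 15),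
`T4CauchySum.InjectedRate`.  For Bałaban's four-dimensional densities NONE of these shapes is printed and none is a theorem of the
tree (the producing modules' WHAT IS NOT PROVED; cell GAPS G-ne1p3-1/3/4).  ABSOLUTE RULE honoured: no programme-internal statement
enters as a hypothesis-free input — every shape is a `def … : Prop` moved under the prefix and asserted of NO datum.

## Why this leaf (and only this)

`T4ApexTelescope` (v2) binds the telescoping lane's generation-2/3 bundles — `TwoRunTelescopeData`, `MidLevelTelescopeData`,
`MidRateTelescopeData`, `GoodBadTelescopeData`, `CanonicalGoodBadTelescopeData` — under the prefix to the targets and headlines.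
Since then the producing lineage WEAKENED its wall twice: generation 7 (`T4ExteriorCovariance`) typed the one-run half (W1) in the
exterior-covariance currency, and generation 8 (`T4SummableDefect`) relaxed BOTH halves — the one-run defects need only a K-uniform
SUMMABLE majorant in the scale distance (`UniformSummableDefect`, ⇐ `UniformGeomDefect`, ⇐ `SummableCovDefect`, ⇐ `UniformCovDefect`),
and the two-run input need only be the CONVERGENCE of the mid-level expectations at each FIXED distance (`MidLimits`, ⇐
`MidDiscrepancyRate` under an injected rate, no schedule, no `Λ ≥ 1`) — concluding `Missing.HasContinuumLimit (D.scheme g₀)`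
(`hasContinuumLimit_of_summableDefect_midLimits`, `…_of_summableCovDefect_ladder`).  Those theorems stop at the Wilson-scheme level:
no module imports `T4SummableDefect`, so the cell's census could not yet read the lane's weakest antecedent against the HEADLINE.
This leaf does exactly that bookkeeping, mirroring `T4ApexTelescope`'s API name for name, and adds one real-analysis identification.

## Contents

§1 (Wilson-scheme level) `SummableTelescopeData D g₀ := UniformSummableDefect D g₀ ∧ MidLimits D g₀` — THE LANE'S WEAKEST BUNDLE;
   `⇐ MidRateTelescopeData`, `⇐ GoodBadTelescopeData` (given `D.AvgMeasurable`), `⇐ CanonicalGoodBadTelescopeData`; the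
   supplier-currency bundles `CovLadderTelescopeData D R g₀` (geometric, generation 7) `⇒ SummableCovLadderTelescopeData D R g₀`
   (summable, generation 8) `⇒ SummableTelescopeData D g₀` along any run ladder `R`; each `⇒ HasContinuumLimit (D.scheme g₀)`,
   and the weakest bundle `⇒ T4ApexHybrid.StringwiseGenFunCauchy (D.scheme g₀)`, `⇒ T4Assembly.GenFunCauchy (D.scheme g₀) l₀`
   (the lane meets the generating-function currency at the apex and only there).
§2 (under the prefix, any compact gauge group) `SummableUnder D Hβ`, `CovLadderUnder D R Hβ`, `SummableCovLadderUnder D R Hβ`,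
   and — the relocation interface supplied by the kernel for level-homogeneous data — `CanonicalSummableCovUnder D hD Hβ`
   (`R := T4RunLadder.runLadder D hD`); the links `GoodBadUnder ⇒ MidRateUnder ⇒ SummableUnder`, `CanonicalGoodBadUnder ⇒ SummableUnder`,
   `CovLadderUnder ⇒ SummableCovLadderUnder ⇒ SummableUnder`; anti-monotonicity in `Hβ`, print-faithful ⇒ scoping-note form;
   `SummableUnder ⇒` a limit functional under the prefix `⇒ StringwiseUnder` / `GenFunCauchyUnder`; one conjunction
   `summable_currencies_chain`; vacuity at data violating (B).
§3 existence / uniqueness targets, both hypothesis forms, and `…existsE'`, from `SummableUnder` and `CanonicalSummableCovUnder`.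
§4 (`SU(N)`, every `N ≥ 1`) ALL FOUR TARGETS from `SummableUnder` for `IsPrintedAveraged`, (0.4)-data `IsBlockAveraged ℰ`, two-level
   data `IsBlockAveraged₂ 𝓜 ℰ`, and from `CanonicalSummableCovUnder` for the same classes (level-homogeneity is the class's theorem);
   the restricted headlines `T4Apex.YM4TorusContinuumPrintedSU(') N` / `…BlockSU N` from each; inhabited-and-vacuous by name.
§5 SERIES FORM AND LOCATED STRICTNESS (real analysis on the cell's sequences; no new shape about densities beyond two
   book-keeping names): `FinalLimits D g₀` (= `MidLimits` at distance `0`: the final-density expectations converge) and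
   `DefectLimits D g₀` (at each fixed distance `n` the normalised one-step defect `K ↦ normDefect D g₀ K Cs n` converges);
   `midExpect K (m+1) − midExpect K m = normDefect K m`; **`MidLimits ⇔ FinalLimits ∧ DefectLimits`**; `FinalMatching ⇒ FinalLimits`
   (the two-run bundle's first component in the new names); under `UniformSummableDefect ∧
   FinalLimits ∧ DefectLimits` the expectations converge to `ℓ_final(Cs) + Σ'_n d_n(Cs)` with `|d_n| ≤ A_n` summable (Tannery) — the
   continuum expectation IS the final-density limit plus the absolutely convergent series of per-step defect limits; and the
   CONVERSE `HasContinuumLimit ∧ UniformSummableDefect ∧ DefectLimits ⇒ FinalLimits`: GIVEN the envelope and the per-distance defect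
   limits, the two-run half of the wall is NECESSARY as well as sufficient (`hasContinuumLimit_iff_midLimits`); under the prefix,
   the existence target ⇔ `FinalLimitsUnder` given `EnvelopeDefectLimitsUnder` (`limit_exists_iff_finalLimitsUnder`).

## Census of the telescoping lane after this file (by name; what is open) — unchanged in substance

For every compact `G`, `D : FiniteEpsData F G` with `hM : D.AvgMeasurable`, `Hβ ∈ {BetaPertHyp D.βfun, DagBinding.EndpointExistence D.C.toB12}`:
  `CanonicalGoodBadUnder ⇒ GoodBadUnder ⇒ MidRateUnder ⇒ SummableUnder ⇒ StringwiseUnder ⇔ (a limit functional under the prefix)`,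
  `CovLadderUnder R ⇒ SummableCovLadderUnder R ⇒ SummableUnder` (any run ladder `R`; the canonical one for level-homogeneous data),
  `MidRateUnder ⇒ MidLevelUnder ⇒ StringwiseUnder` and `TwoRunUnder ⇒ StringwiseUnder` (`T4ApexTelescope`; no implication between
  `MidLevelUnder` / `TwoRunUnder` and `SummableUnder` is typed either way).
OPEN for Bałaban's scheme: EVERY antecedent — in the weakest typing, per tuned scheme, `UniformSummableDefect D g₀` (W1∞) and
`MidLimits D g₀` (W2′) = `FinalLimits ∧ DefectLimits`; in the suppliers' currency `SummableCovDefect D g₀` and `LadderGoodBadRate D R g₀ Λ E ρ inj`.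
None is printed ([Balaban1989LargeFieldII] p. 356), none is a theorem of the tree, and no printed-averaged datum satisfying (B) is
constructed anywhere in the tree (the inhabitants are placeholders at which (B) is false and everything here is vacuous).
STRICTNESS, now located (§5): per tuned scheme, (W1∞) ∧ (W2′) ⟺ `HasContinuumLimit (D.scheme g₀)` ∧ (W1∞) ∧ `DefectLimits D g₀`
(`hasContinuumLimit_iff_summableTelescopeData`): the sufficient condition exceeds the target exactly by the envelope and the
per-distance defect limits, while (W2′)'s remaining part `FinalLimits` is implied back.  No converse for (W1∞) or `DefectLimits` is
claimed (defects may oscillate in `K` while their sums converge).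

DIVERGENCES inherited, not new (HOME/DIVERGENCE.md D-t4l.1–17; the producing modules' conventions — normalised defects divided by
`∫ρ_K^{(K)}`, push-forward level laws — enter only through their theorems).  The instance binder `[∀ K j, DecidableEq (PBond (F.P K) j)]`
of the covariance-currency shapes is bookkeeping (fibre sums over finite bond sets), as in `T4ExteriorCovariance` §4.

Version: v1 (t4-ne1p-p3 gen 18, 2026-08-19), typed against `T4ApexTelescope` v2 (p185896 lineage), `T4SummableDefect` v1 (p189790) /
v1.1 (docfix only), `T4ExteriorCovariance` v1.1 (p189826), `T4ObservableTelescopeTwoRun` v3.2 (p185738), `T4RunLadder` v1.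
-/

noncomputable section

open MeasureTheory Filter Topology
open scoped BigOperators

namespace Literature.MathematicalPhysics.QuantumFieldTheory.Balaban1983to89

open Missing T4Continuum T4CauchySum T4ObservableTelescopeTwoRun T4ExteriorCovariance T4SummableDefect T4ApexTelescope

namespace T4ApexSummable

/-! ## §1 Wilson-scheme level: the weakest bundle, the supplier-currency bundles, and their place in the lane -/

section Scheme

variable {F : T4Family} {G : Type*} [GaugeGroup G] [MeasurableSpace G] [HaarData G]

/-- HYPOTHESIS SHAPE (a bundle of two upstream shapes; NOT PRINTED, never asserted) — **THE LANE'S WEAKEST DATA**: a K-uniform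
summable envelope of the one-run defects `UniformSummableDefect D g₀` (W1∞) and the convergence of the mid-level expectations at every
fixed distance `MidLimits D g₀` (W2′).  Exactly the two binders of `T4SummableDefect.hasContinuumLimit_of_summableDefect_midLimits`.
[folklore] -/
def SummableTelescopeData (D : FiniteEpsData F G) (g₀ : ℕ → ℝ) : Prop :=
  UniformSummableDefect D g₀ ∧ MidLimits D g₀

/-- `MidRateTelescopeData ⇒ SummableTelescopeData` (geometric ⇒ summable envelope; a mid-level discrepancy rate under an injected
rate ⇒ mid-level limits, no schedule, the volume factor `Λ ≥ 1` unused). [folklore] -/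
theorem summableTelescopeData_of_midRate (D : FiniteEpsData F G) (g₀ : ℕ → ℝ) (h : MidRateTelescopeData D g₀) :
    SummableTelescopeData D g₀ := by
  obtain ⟨hU, C, θ, E, ρ, Λ, c, inj, hinj, hE, hθ, hθ1, hρ, hρ1, _, hR⟩ := h
  exact ⟨uniformSummableDefect_of_uniformGeomDefect D g₀ hU, midLimits_of_midDiscrepancyRate D g₀ hinj hE hθ hθ1 hρ hρ1 hR⟩

/-- `GoodBadTelescopeData ⇒ SummableTelescopeData`, for data with measurable averaging maps (through `MidRateTelescopeData`). [folklore] -/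
theorem summableTelescopeData_of_goodBad [RegularGaugeGroup G] (D : FiniteEpsData F G) (hM : D.AvgMeasurable) (g₀ : ℕ → ℝ)
    (h : GoodBadTelescopeData D g₀) : SummableTelescopeData D g₀ :=
  summableTelescopeData_of_midRate D g₀ (midRateTelescopeData_of_goodBad D hM g₀ h)

/-- `CanonicalGoodBadTelescopeData ⇒ SummableTelescopeData` (level-homogeneous data, the kernel's run ladder). [folklore] -/
theorem summableTelescopeData_of_canonicalGoodBad [RegularGaugeGroup G] (D : FiniteEpsData F G) (hM : D.AvgMeasurable)
    (hD : D.AvgLevelHomogeneous) (g₀ : ℕ → ℝ) (h : CanonicalGoodBadTelescopeData D hD g₀) : SummableTelescopeData D g₀ :=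
  summableTelescopeData_of_goodBad D hM g₀ (goodBadTelescopeData_of_canonical D hD g₀ h)

/-- **`SummableTelescopeData ⇒ HasContinuumLimit (D.scheme g₀)`** — the producing lineage's existence theorem
`hasContinuumLimit_of_summableDefect_midLimits`, bundled.  CONDITIONAL on both shapes, neither printed nor proved. [folklore] -/
theorem hasContinuumLimit_of_summableTelescopeData [RegularGaugeGroup G] (D : FiniteEpsData F G) (hM : D.AvgMeasurable)
    (g₀ : ℕ → ℝ) (h : SummableTelescopeData D g₀) : HasContinuumLimit (D.scheme g₀) :=
  hasContinuumLimit_of_summableDefect_midLimits D hM g₀ h.1 h.2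

/-- The weakest bundle ⇒ per-string Cauchy radii of the log-generating functions (the lane meets the generating-function currency
at the apex and only there; `T4ApexTelescope.stringwise_of_hasContinuumLimit`). [folklore] -/
theorem stringwise_of_summableTelescopeData [RegularGaugeGroup G] (D : FiniteEpsData F G) (hM : D.AvgMeasurable) (g₀ : ℕ → ℝ)
    (h : SummableTelescopeData D g₀) : T4ApexHybrid.StringwiseGenFunCauchy (D.scheme g₀) :=
  stringwise_of_hasContinuumLimit D hM g₀ (hasContinuumLimit_of_summableTelescopeData D hM g₀ h)

/-- … and ⇒ `T4Assembly.GenFunCauchy (D.scheme g₀) l₀` for every `l₀`. [folklore] -/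
theorem genFunCauchy_of_summableTelescopeData [RegularGaugeGroup G] (D : FiniteEpsData F G) (hM : D.AvgMeasurable)
    (g₀ : ℕ → ℝ) (h : SummableTelescopeData D g₀) (l₀ : ℝ) : T4Assembly.GenFunCauchy (D.scheme g₀) l₀ :=
  genFunCauchy_of_hasContinuumLimit D hM g₀ (hasContinuumLimit_of_summableTelescopeData D hM g₀ h) l₀

variable [∀ K j : ℕ, DecidableEq (PBond (F.P K) j)]

/-- HYPOTHESIS SHAPE (bundle; NOT PRINTED, never asserted) — **THE SUPPLIER-CURRENCY DATA, GEOMETRIC FORM, ALONG A RUN LADDER `R`**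
(generation 7): the one-run half (W1) as geometric exterior-covariance budgets `UniformCovDefect D g₀` and, for SOME injected rate
`InjectedRate C c θ inj` with `θ ∈ [0,1[`, contraction `ρ ∈ [0,1[`, constant `E ≥ 0` and volume factor `Λ` (NO `Λ ≥ 1`: the
summable-envelope route does not use it), the good/bad density datum `LadderGoodBadRate D R g₀ Λ E ρ inj` along `R`. [folklore] -/
def CovLadderTelescopeData (D : FiniteEpsData F G) (R : RunLadder D) (g₀ : ℕ → ℝ) : Prop :=
  UniformCovDefect D g₀ ∧ ∃ (C θ E ρ Λ : ℝ) (c : ℕ) (inj : ℕ → ℕ → ℝ), InjectedRate C c θ inj ∧ 0 ≤ E ∧ 0 ≤ θ ∧ θ < 1 ∧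
    0 ≤ ρ ∧ ρ < 1 ∧ LadderGoodBadRate D R g₀ Λ E ρ inj

/-- HYPOTHESIS SHAPE (bundle; NOT PRINTED, never asserted) — **THE SUPPLIER-CURRENCY DATA, SUMMABLE FORM, ALONG A RUN LADDER `R`**
(generation 8): `SummableCovDefect D g₀` (per-step exterior-covariance budgets with a distance-only SUMMABLE envelope) and the same
parametrised good/bad datum along `R`.  Exactly the binders of `T4SummableDefect.hasContinuumLimit_of_summableCovDefect_ladder`. [folklore] -/
def SummableCovLadderTelescopeData (D : FiniteEpsData F G) (R : RunLadder D) (g₀ : ℕ → ℝ) : Prop :=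
  SummableCovDefect D g₀ ∧ ∃ (C θ E ρ Λ : ℝ) (c : ℕ) (inj : ℕ → ℕ → ℝ), InjectedRate C c θ inj ∧ 0 ≤ E ∧ 0 ≤ θ ∧ θ < 1 ∧
    0 ≤ ρ ∧ ρ < 1 ∧ LadderGoodBadRate D R g₀ Λ E ρ inj

/-- Geometric ⇒ summable supplier data (`summableCovDefect_of_uniformCovDefect`, same parameters). [folklore] -/
theorem summableCovLadder_of_covLadder (D : FiniteEpsData F G) (R : RunLadder D) (g₀ : ℕ → ℝ)
    (h : CovLadderTelescopeData D R g₀) : SummableCovLadderTelescopeData D R g₀ :=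
  ⟨summableCovDefect_of_uniformCovDefect D g₀ h.1, h.2⟩

/-- **THE SUPPLIER-CURRENCY DATA FEED THE WEAKEST BUNDLE**: `SummableCovLadderTelescopeData D R g₀ ⇒ SummableTelescopeData D g₀`,
for data with measurable averaging maps (`uniformSummableDefect_of_summableCovDefect`; `midGoodBadRate_of_ladder`,
`midDiscrepancyRate_of_goodBad`, `midLimits_of_midDiscrepancyRate`). [folklore] -/
theorem summableTelescopeData_of_summableCovLadder [RegularGaugeGroup G] (D : FiniteEpsData F G) (hM : D.AvgMeasurable)
    (R : RunLadder D) (g₀ : ℕ → ℝ) (h : SummableCovLadderTelescopeData D R g₀) : SummableTelescopeData D g₀ := by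
  obtain ⟨hW, C, θ, E, ρ, Λ, c, inj, hinj, hE, hθ, hθ1, hρ, hρ1, hR⟩ := h
  exact ⟨uniformSummableDefect_of_summableCovDefect D hM g₀ hW, midLimits_of_midDiscrepancyRate D g₀ hinj hE hθ hθ1 hρ hρ1
    (midDiscrepancyRate_of_goodBad D hM g₀ (midGoodBadRate_of_ladder D R g₀ hR))⟩

/-- `CovLadderTelescopeData D R g₀ ⇒ SummableTelescopeData D g₀`. [folklore] -/
theorem summableTelescopeData_of_covLadder [RegularGaugeGroup G] (D : FiniteEpsData F G) (hM : D.AvgMeasurable)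
    (R : RunLadder D) (g₀ : ℕ → ℝ) (h : CovLadderTelescopeData D R g₀) : SummableTelescopeData D g₀ :=
  summableTelescopeData_of_summableCovLadder D hM R g₀ (summableCovLadder_of_covLadder D R g₀ h)

/-- `SummableCovLadderTelescopeData ⇒ HasContinuumLimit (D.scheme g₀)` (= the upstream `hasContinuumLimit_of_summableCovDefect_ladder`,
bundled). [folklore] -/
theorem hasContinuumLimit_of_summableCovLadder [RegularGaugeGroup G] (D : FiniteEpsData F G) (hM : D.AvgMeasurable)
    (R : RunLadder D) (g₀ : ℕ → ℝ) (h : SummableCovLadderTelescopeData D R g₀) : HasContinuumLimit (D.scheme g₀) :=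
  hasContinuumLimit_of_summableTelescopeData D hM g₀ (summableTelescopeData_of_summableCovLadder D hM R g₀ h)

/-- `CovLadderTelescopeData ⇒ HasContinuumLimit (D.scheme g₀)` (generation 7's `hasContinuumLimit_of_covDefect_ladder` WITHOUT its
`1 ≤ Λ`, through the summable route). [folklore] -/
theorem hasContinuumLimit_of_covLadder [RegularGaugeGroup G] (D : FiniteEpsData F G) (hM : D.AvgMeasurable)
    (R : RunLadder D) (g₀ : ℕ → ℝ) (h : CovLadderTelescopeData D R g₀) : HasContinuumLimit (D.scheme g₀) :=
  hasContinuumLimit_of_summableTelescopeData D hM g₀ (summableTelescopeData_of_covLadder D hM R g₀ h)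

end Scheme

/-! ## §2 Under the targets' quantifier prefix (any compact gauge group) -/

section Prefix

variable {F : T4Family} {G : Type*} [GaugeGroup G] [MeasurableSpace G] [HaarData G]

/-- HYPOTHESIS SHAPE — **THE LANE'S WEAKEST DATA UNDER THE PREFIX**: under (B) for the construction and the β-side hypothesis `Hβ`,
for all small `γ`, `g` and every bare-coupling sequence `g₀` tuned to `g`, `SummableTelescopeData D g₀` = summable envelope of the
one-run defects ∧ mid-level limits at every fixed distance.  NOT PRINTED for Bałaban's densities; never asserted. [folklore] -/
def SummableUnder (D : FiniteEpsData F G) (Hβ : Prop) : Prop :=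
  D.UnderHypotheses Hβ fun g₀ => SummableTelescopeData D g₀

/-- `MidRateUnder ⇒ SummableUnder` (no measurability needed). [folklore] -/
theorem summableUnder_of_midRateUnder (D : FiniteEpsData F G) {Hβ : Prop} (h : MidRateUnder D Hβ) : SummableUnder D Hβ :=
  FiniteEpsData.UnderHypotheses.mono (fun g₀ hg => summableTelescopeData_of_midRate D g₀ hg) h

/-- `GoodBadUnder ⇒ SummableUnder`, for data with measurable averaging maps. [folklore] -/
theorem summableUnder_of_goodBadUnder [RegularGaugeGroup G] (D : FiniteEpsData F G) (hM : D.AvgMeasurable) {Hβ : Prop}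
    (h : GoodBadUnder D Hβ) : SummableUnder D Hβ :=
  summableUnder_of_midRateUnder D (midRateUnder_of_goodBadUnder D hM h)

/-- `CanonicalGoodBadUnder ⇒ SummableUnder` (level-homogeneous data). [folklore] -/
theorem summableUnder_of_canonicalGoodBadUnder [RegularGaugeGroup G] (D : FiniteEpsData F G) (hM : D.AvgMeasurable)
    (hD : D.AvgLevelHomogeneous) {Hβ : Prop} (h : CanonicalGoodBadUnder D hD Hβ) : SummableUnder D Hβ :=
  summableUnder_of_goodBadUnder D hM (goodBadUnder_of_canonicalUnder D hD h)

/-- [folklore] -/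
theorem SummableUnder.of_imp {D : FiniteEpsData F G} {H₁ H₂ : Prop} (himp : H₂ → H₁) (h : SummableUnder D H₁) :
    SummableUnder D H₂ :=
  FiniteEpsData.UnderHypotheses.of_imp himp h

/-- [folklore] -/
theorem SummableUnder.of_endpoint {D : FiniteEpsData F G} (h : SummableUnder D (DagBinding.EndpointExistence D.C.toB12)) :
    SummableUnder D (BetaPertHyp D.βfun) :=
  FiniteEpsData.UnderHypotheses.of_endpoint h

/-- **`SummableUnder D Hβ` ⇒ A LIMIT FUNCTIONAL EXISTS UNDER THE PREFIX**, for data with measurable averaging maps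
(`hasContinuumLimit_of_summableTelescopeData` + `Missing.hasContinuumLimit_iff_exists_isLimitFunctional`). [folklore] -/
theorem underHypotheses_exists_of_summableUnder [RegularGaugeGroup G] (D : FiniteEpsData F G) (hM : D.AvgMeasurable) {Hβ : Prop}
    (h : SummableUnder D Hβ) :
    D.UnderHypotheses Hβ fun g₀ => ∃ E : List (ULoop F) → ℝ, IsLimitFunctional (D.scheme g₀).expectAt E :=
  FiniteEpsData.UnderHypotheses.mono (fun g₀ hg => (hasContinuumLimit_iff_exists_isLimitFunctional (D.scheme g₀)).mp
    (hasContinuumLimit_of_summableTelescopeData D hM g₀ hg)) h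

/-- **`SummableUnder ⇒ StringwiseUnder`** (per-string Cauchy radii under the prefix). [folklore] -/
theorem stringwiseUnder_of_summableUnder [RegularGaugeGroup G] (D : FiniteEpsData F G) (hM : D.AvgMeasurable) {Hβ : Prop}
    (h : SummableUnder D Hβ) : T4ApexHybrid.StringwiseUnder D Hβ :=
  FiniteEpsData.UnderHypotheses.mono (fun g₀ hg => stringwise_of_summableTelescopeData D hM g₀ hg) h

/-- **`SummableUnder ⇒ GenFunCauchyUnder`** (node U6's output under the prefix, radius `1`). [folklore] -/
theorem genFunCauchyUnder_of_summableUnder [RegularGaugeGroup G] (D : FiniteEpsData F G) (hM : D.AvgMeasurable) {Hβ : Prop}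
    (h : SummableUnder D Hβ) : T4Assembly.GenFunCauchyUnder D Hβ :=
  FiniteEpsData.UnderHypotheses.mono (fun g₀ hg => ⟨1, one_pos, genFunCauchy_of_summableTelescopeData D hM g₀ hg 1⟩) h

/-- Vacuity: at a datum violating (B) the shape `SummableUnder D Hβ` holds trivially, for every `Hβ`. [folklore] -/
theorem summableUnder_of_not_endStatementBPrinted (D : FiniteEpsData F G) (hB : ¬ B16.EndStatementBPrinted D.C) (Hβ : Prop) :
    SummableUnder D Hβ :=
  fun h => absurd h hB

section Cov

variable [∀ K j : ℕ, DecidableEq (PBond (F.P K) j)]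

/-- HYPOTHESIS SHAPE — **THE GEOMETRIC SUPPLIER-CURRENCY DATA ALONG A RUN LADDER `R`, UNDER THE PREFIX.**  NOT PRINTED; never
asserted. [folklore] -/
def CovLadderUnder (D : FiniteEpsData F G) (R : RunLadder D) (Hβ : Prop) : Prop :=
  D.UnderHypotheses Hβ fun g₀ => CovLadderTelescopeData D R g₀

/-- HYPOTHESIS SHAPE — **THE SUMMABLE SUPPLIER-CURRENCY DATA ALONG A RUN LADDER `R`, UNDER THE PREFIX.**  NOT PRINTED; never
asserted. [folklore] -/
def SummableCovLadderUnder (D : FiniteEpsData F G) (R : RunLadder D) (Hβ : Prop) : Prop :=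
  D.UnderHypotheses Hβ fun g₀ => SummableCovLadderTelescopeData D R g₀

/-- HYPOTHESIS SHAPE — **THE SUMMABLE SUPPLIER-CURRENCY DATA ALONG THE CANONICAL LADDER** of a datum with level-homogeneous
averagings `hD` (`T4RunLadder.runLadder D hD`, the kernel's `T4LevelShift.ladderShift`), UNDER THE PREFIX — so that NO interface datum
is left to a supplier: what it asks is analytic only (summable exterior-covariance step budgets; an injected rate; normalised level
laws with a good/bad density datum along the kernel's relocation).  NOT PRINTED; never asserted. [folklore] -/
def CanonicalSummableCovUnder (D : FiniteEpsData F G) (hD : D.AvgLevelHomogeneous) (Hβ : Prop) : Prop :=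
  SummableCovLadderUnder D (T4RunLadder.runLadder D hD) Hβ

/-- `CovLadderUnder ⇒ SummableCovLadderUnder`. [folklore] -/
theorem summableCovLadderUnder_of_covLadderUnder (D : FiniteEpsData F G) (R : RunLadder D) {Hβ : Prop}
    (h : CovLadderUnder D R Hβ) : SummableCovLadderUnder D R Hβ :=
  FiniteEpsData.UnderHypotheses.mono (fun g₀ hg => summableCovLadder_of_covLadder D R g₀ hg) h

/-- **`SummableCovLadderUnder ⇒ SummableUnder`**, for data with measurable averaging maps. [folklore] -/
theorem summableUnder_of_summableCovLadderUnder [RegularGaugeGroup G] (D : FiniteEpsData F G) (hM : D.AvgMeasurable)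
    (R : RunLadder D) {Hβ : Prop} (h : SummableCovLadderUnder D R Hβ) : SummableUnder D Hβ :=
  FiniteEpsData.UnderHypotheses.mono (fun g₀ hg => summableTelescopeData_of_summableCovLadder D hM R g₀ hg) h

/-- `CovLadderUnder ⇒ SummableUnder`. [folklore] -/
theorem summableUnder_of_covLadderUnder [RegularGaugeGroup G] (D : FiniteEpsData F G) (hM : D.AvgMeasurable)
    (R : RunLadder D) {Hβ : Prop} (h : CovLadderUnder D R Hβ) : SummableUnder D Hβ :=
  summableUnder_of_summableCovLadderUnder D hM R (summableCovLadderUnder_of_covLadderUnder D R h)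

/-- **`CanonicalSummableCovUnder ⇒ SummableUnder`** (level-homogeneous data with measurable averaging maps). [folklore] -/
theorem summableUnder_of_canonicalSummableCovUnder [RegularGaugeGroup G] (D : FiniteEpsData F G) (hM : D.AvgMeasurable)
    (hD : D.AvgLevelHomogeneous) {Hβ : Prop} (h : CanonicalSummableCovUnder D hD Hβ) : SummableUnder D Hβ :=
  summableUnder_of_summableCovLadderUnder D hM _ h

/-- [folklore] -/
theorem CovLadderUnder.of_imp {D : FiniteEpsData F G} {R : RunLadder D} {H₁ H₂ : Prop} (himp : H₂ → H₁)
    (h : CovLadderUnder D R H₁) : CovLadderUnder D R H₂ :=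
  FiniteEpsData.UnderHypotheses.of_imp himp h

/-- [folklore] -/
theorem CovLadderUnder.of_endpoint {D : FiniteEpsData F G} {R : RunLadder D}
    (h : CovLadderUnder D R (DagBinding.EndpointExistence D.C.toB12)) : CovLadderUnder D R (BetaPertHyp D.βfun) :=
  FiniteEpsData.UnderHypotheses.of_endpoint h

/-- [folklore] -/
theorem SummableCovLadderUnder.of_imp {D : FiniteEpsData F G} {R : RunLadder D} {H₁ H₂ : Prop} (himp : H₂ → H₁)
    (h : SummableCovLadderUnder D R H₁) : SummableCovLadderUnder D R H₂ :=
  FiniteEpsData.UnderHypotheses.of_imp himp h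

/-- [folklore] -/
theorem SummableCovLadderUnder.of_endpoint {D : FiniteEpsData F G} {R : RunLadder D}
    (h : SummableCovLadderUnder D R (DagBinding.EndpointExistence D.C.toB12)) : SummableCovLadderUnder D R (BetaPertHyp D.βfun) :=
  FiniteEpsData.UnderHypotheses.of_endpoint h

/-- [folklore] -/
theorem CanonicalSummableCovUnder.of_imp {D : FiniteEpsData F G} {hD : D.AvgLevelHomogeneous} {H₁ H₂ : Prop} (himp : H₂ → H₁)
    (h : CanonicalSummableCovUnder D hD H₁) : CanonicalSummableCovUnder D hD H₂ :=
  FiniteEpsData.UnderHypotheses.of_imp himp h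

/-- [folklore] -/
theorem CanonicalSummableCovUnder.of_endpoint {D : FiniteEpsData F G} {hD : D.AvgLevelHomogeneous}
    (h : CanonicalSummableCovUnder D hD (DagBinding.EndpointExistence D.C.toB12)) :
    CanonicalSummableCovUnder D hD (BetaPertHyp D.βfun) :=
  FiniteEpsData.UnderHypotheses.of_endpoint h

/-- Vacuity at a datum violating (B), for the supplier-currency shapes. [folklore] -/
theorem summableCovLadderUnder_of_not_endStatementBPrinted (D : FiniteEpsData F G) (R : RunLadder D)
    (hB : ¬ B16.EndStatementBPrinted D.C) (Hβ : Prop) : SummableCovLadderUnder D R Hβ :=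
  fun h => absurd h hB

/-- [folklore] -/
theorem canonicalSummableCovUnder_of_not_endStatementBPrinted (D : FiniteEpsData F G) (hD : D.AvgLevelHomogeneous)
    (hB : ¬ B16.EndStatementBPrinted D.C) (Hβ : Prop) : CanonicalSummableCovUnder D hD Hβ :=
  fun h => absurd h hB

/-- **THE TELESCOPING LANE UNDER THE PREFIX AFTER GENERATION 8, IN ONE CONJUNCTION** (the census by name): for data with measurable
averaging maps, any run ladder `R` and any `Hβ`, `GoodBadUnder ⇒ MidRateUnder ⇒ SummableUnder ⇒ StringwiseUnder`,
`CovLadderUnder R ⇒ SummableCovLadderUnder R ⇒ SummableUnder`, and `StringwiseUnder ⇔` existence of a limit functional under the prefix.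
Every antecedent is, for Bałaban's densities, a located new estimate, none in print; nothing is asserted. [folklore] -/
theorem summable_currencies_chain [RegularGaugeGroup G] (D : FiniteEpsData F G) (hM : D.AvgMeasurable) (R : RunLadder D)
    (Hβ : Prop) :
    (GoodBadUnder D Hβ → MidRateUnder D Hβ) ∧ (MidRateUnder D Hβ → SummableUnder D Hβ) ∧
      (CovLadderUnder D R Hβ → SummableCovLadderUnder D R Hβ) ∧ (SummableCovLadderUnder D R Hβ → SummableUnder D Hβ) ∧
      (SummableUnder D Hβ → T4ApexHybrid.StringwiseUnder D Hβ) ∧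
      (T4ApexHybrid.StringwiseUnder D Hβ ↔
        D.UnderHypotheses Hβ fun g₀ => ∃ E : List (ULoop F) → ℝ, IsLimitFunctional (D.scheme g₀).expectAt E) :=
  ⟨midRateUnder_of_goodBadUnder D hM, summableUnder_of_midRateUnder D, summableCovLadderUnder_of_covLadderUnder D R,
    summableUnder_of_summableCovLadderUnder D hM R, stringwiseUnder_of_summableUnder D hM,
    (T4ApexHybrid.underHypotheses_exists_iff_stringwiseUnder D hM Hβ).symm⟩

end Cov

/-! ## §3 Binding to the targets (existence, uniqueness; both hypothesis forms) -/

/-- **`SummableUnder D (BetaPertHyp D.βfun)` ⇒ THE EXISTENCE TARGET**, for data with measurable averaging maps. [folklore] -/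
theorem limit_exists_of_summableUnder [RegularGaugeGroup G] (D : FiniteEpsData F G) (hM : D.AvgMeasurable)
    (h : SummableUnder D (BetaPertHyp D.βfun)) : D.ym4_torus_continuum_limit_exists :=
  underHypotheses_exists_of_summableUnder D hM h

/-- … and the uniqueness target (`limit_unique_of_limit_exists`). [folklore] -/
theorem limit_unique_of_summableUnder [RegularGaugeGroup G] (D : FiniteEpsData F G) (hM : D.AvgMeasurable)
    (h : SummableUnder D (BetaPertHyp D.βfun)) : D.ym4_torus_continuum_limit_unique :=
  D.limit_unique_of_limit_exists (limit_exists_of_summableUnder D hM h)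

/-- Print-faithful form (`DagBinding.EndpointExistence D.C.toB12`). [folklore] -/
theorem limit_exists'_of_summableUnder' [RegularGaugeGroup G] (D : FiniteEpsData F G) (hM : D.AvgMeasurable)
    (h : SummableUnder D (DagBinding.EndpointExistence D.C.toB12)) : D.ym4_torus_continuum_limit_exists' :=
  underHypotheses_exists_of_summableUnder D hM h

/-- Print-faithful uniqueness (`limit_unique'_of_limit_exists'`). [folklore] -/
theorem limit_unique'_of_summableUnder' [RegularGaugeGroup G] (D : FiniteEpsData F G) (hM : D.AvgMeasurable)
    (h : SummableUnder D (DagBinding.EndpointExistence D.C.toB12)) : D.ym4_torus_continuum_limit_unique' :=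
  D.limit_unique'_of_limit_exists' (limit_exists'_of_summableUnder' D hM h)

/-- … hence the print-closest ∃-form target (`limit_existsE'_of_exists'`). [folklore] -/
theorem limit_existsE'_of_summableUnder' [RegularGaugeGroup G] (D : FiniteEpsData F G) (hM : D.AvgMeasurable)
    (h : SummableUnder D (DagBinding.EndpointExistence D.C.toB12)) : D.ym4_torus_continuum_limit_existsE' :=
  D.limit_existsE'_of_exists' (limit_exists'_of_summableUnder' D hM h)

section CovTargets

variable [∀ K j : ℕ, DecidableEq (PBond (F.P K) j)]

/-- **`SummableCovLadderUnder D R (BetaPertHyp D.βfun)` ⇒ THE EXISTENCE TARGET** (any run ladder). [folklore] -/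
theorem limit_exists_of_summableCovLadderUnder [RegularGaugeGroup G] (D : FiniteEpsData F G) (hM : D.AvgMeasurable)
    (R : RunLadder D) (h : SummableCovLadderUnder D R (BetaPertHyp D.βfun)) : D.ym4_torus_continuum_limit_exists :=
  limit_exists_of_summableUnder D hM (summableUnder_of_summableCovLadderUnder D hM R h)

/-- **`CanonicalSummableCovUnder D hD (BetaPertHyp D.βfun)` ⇒ THE EXISTENCE TARGET.** [folklore] -/
theorem limit_exists_of_canonicalSummableCovUnder [RegularGaugeGroup G] (D : FiniteEpsData F G) (hM : D.AvgMeasurable)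
    (hD : D.AvgLevelHomogeneous) (h : CanonicalSummableCovUnder D hD (BetaPertHyp D.βfun)) :
    D.ym4_torus_continuum_limit_exists :=
  limit_exists_of_summableUnder D hM (summableUnder_of_canonicalSummableCovUnder D hM hD h)

/-- … and the uniqueness target. [folklore] -/
theorem limit_unique_of_canonicalSummableCovUnder [RegularGaugeGroup G] (D : FiniteEpsData F G) (hM : D.AvgMeasurable)
    (hD : D.AvgLevelHomogeneous) (h : CanonicalSummableCovUnder D hD (BetaPertHyp D.βfun)) :
    D.ym4_torus_continuum_limit_unique :=
  limit_unique_of_summableUnder D hM (summableUnder_of_canonicalSummableCovUnder D hM hD h)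

/-- Print-faithful form. [folklore] -/
theorem limit_exists'_of_canonicalSummableCovUnder' [RegularGaugeGroup G] (D : FiniteEpsData F G) (hM : D.AvgMeasurable)
    (hD : D.AvgLevelHomogeneous) (h : CanonicalSummableCovUnder D hD (DagBinding.EndpointExistence D.C.toB12)) :
    D.ym4_torus_continuum_limit_exists' :=
  limit_exists'_of_summableUnder' D hM (summableUnder_of_canonicalSummableCovUnder D hM hD h)

/-- Print-faithful uniqueness. [folklore] -/
theorem limit_unique'_of_canonicalSummableCovUnder' [RegularGaugeGroup G] (D : FiniteEpsData F G) (hM : D.AvgMeasurable)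
    (hD : D.AvgLevelHomogeneous) (h : CanonicalSummableCovUnder D hD (DagBinding.EndpointExistence D.C.toB12)) :
    D.ym4_torus_continuum_limit_unique' :=
  limit_unique'_of_summableUnder' D hM (summableUnder_of_canonicalSummableCovUnder D hM hD h)

/-- … hence the ∃-form target. [folklore] -/
theorem limit_existsE'_of_canonicalSummableCovUnder' [RegularGaugeGroup G] (D : FiniteEpsData F G) (hM : D.AvgMeasurable)
    (hD : D.AvgLevelHomogeneous) (h : CanonicalSummableCovUnder D hD (DagBinding.EndpointExistence D.C.toB12)) :
    D.ym4_torus_continuum_limit_existsE' :=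
  limit_existsE'_of_summableUnder' D hM (summableUnder_of_canonicalSummableCovUnder D hM hD h)

end CovTargets

end Prefix

/-! ## §4 The apex on `SU(N)`, every `N ≥ 1`: the printed classes, (0.4)-data, two-level data; the restricted headlines -/

section SU

variable {F : T4Family} {N : ℕ} [NeZero N] {D : FiniteEpsData F (Matrix.specialUnitaryGroup (Fin N) ℂ)}
  {𝓜 : GroupAverage (Matrix.specialUnitaryGroup (Fin N) ℂ)} {ℰ : LoopAverage (Matrix.specialUnitaryGroup (Fin N) ℂ)}

/-- **THE APEX FED BY THE LANE'S WEAKEST DATA — THE PRINTED PRESCRIPTIONS (0.4) / (0.10)–(0.12) on `SU(N)`, NO SIDE HYPOTHESIS**: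
`SummableUnder D (BetaPertHyp D.βfun)` ⇒ ALL FOUR TARGETS (measurability of the printed averaging maps is the class's theorem
`IsPrintedAveraged.avgMeasurable`; RP / COV of the limit are the class's theorems, re-used). [folklore] -/
theorem printed_targets_of_summableUnder (h : D.IsPrintedAveraged) (hR : SummableUnder D (BetaPertHyp D.βfun)) :
    D.ym4_torus_continuum_limit_exists ∧ D.ym4_torus_continuum_limit_unique ∧
      D.limit_reflectionPositive ∧ D.limit_torusCovariant :=
  h.targets_of_exists (limit_exists_of_summableUnder D h.avgMeasurable hR)

/-- Print-faithful form. [folklore] -/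
theorem printed_targets'_of_summableUnder' (h : D.IsPrintedAveraged)
    (hR : SummableUnder D (DagBinding.EndpointExistence D.C.toB12)) :
    D.ym4_torus_continuum_limit_exists' ∧ D.ym4_torus_continuum_limit_unique' ∧
      D.limit_reflectionPositive' ∧ D.limit_torusCovariant' :=
  h.targets'_of_exists' (limit_exists'_of_summableUnder' D h.avgMeasurable hR)

/-- (0.4)-DATA `IsBlockAveraged ℰ` with a measurable small-loop average: `SummableUnder` ⇒ all four targets. [folklore] -/
theorem targets_of_summableUnder (h : D.IsBlockAveraged ℰ) (hE : ℰ.MeasurableE) (hR : SummableUnder D (BetaPertHyp D.βfun)) :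
    D.ym4_torus_continuum_limit_exists ∧ D.ym4_torus_continuum_limit_unique ∧
      D.limit_reflectionPositive ∧ D.limit_torusCovariant :=
  h.targets_of_exists hE (limit_exists_of_summableUnder D (h.avgMeasurable hE) hR)

/-- Print-faithful form. [folklore] -/
theorem targets'_of_summableUnder' (h : D.IsBlockAveraged ℰ) (hE : ℰ.MeasurableE)
    (hR : SummableUnder D (DagBinding.EndpointExistence D.C.toB12)) :
    D.ym4_torus_continuum_limit_exists' ∧ D.ym4_torus_continuum_limit_unique' ∧
      D.limit_reflectionPositive' ∧ D.limit_torusCovariant' :=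
  h.targets'_of_exists' hE (limit_exists'_of_summableUnder' D (h.avgMeasurable hE) hR)

/-- TWO-LEVEL (0.11)–(0.12)-DATA with measurable averages: `SummableUnder` ⇒ all four targets. [folklore] -/
theorem targets₂_of_summableUnder (h : D.IsBlockAveraged₂ 𝓜 ℰ) (hM : 𝓜.MeasurableM) (hE : ℰ.MeasurableE)
    (hR : SummableUnder D (BetaPertHyp D.βfun)) :
    D.ym4_torus_continuum_limit_exists ∧ D.ym4_torus_continuum_limit_unique ∧
      D.limit_reflectionPositive ∧ D.limit_torusCovariant :=
  h.targets_of_exists hM hE (limit_exists_of_summableUnder D (h.avgMeasurable hM hE) hR)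

variable [∀ K j : ℕ, DecidableEq (PBond (F.P K) j)]

/-- **THE PRINTED PRESCRIPTIONS on `SU(N)`: the summable supplier-currency data along the CANONICAL ladder under the prefix ⇒ ALL
FOUR TARGETS** — NO interface datum and NO side hypothesis: measurability, level-homogeneity (`avgLevelHomogeneous_of_printed`), the
run ladder, RP and COV are the class's theorems. [folklore] -/
theorem printed_targets_of_canonicalSummableCovUnder (h : D.IsPrintedAveraged)
    (hR : CanonicalSummableCovUnder D (avgLevelHomogeneous_of_printed h) (BetaPertHyp D.βfun)) :
    D.ym4_torus_continuum_limit_exists ∧ D.ym4_torus_continuum_limit_unique ∧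
      D.limit_reflectionPositive ∧ D.limit_torusCovariant :=
  printed_targets_of_summableUnder h (summableUnder_of_canonicalSummableCovUnder D h.avgMeasurable _ hR)

/-- Print-faithful form. [folklore] -/
theorem printed_targets'_of_canonicalSummableCovUnder' (h : D.IsPrintedAveraged)
    (hR : CanonicalSummableCovUnder D (avgLevelHomogeneous_of_printed h) (DagBinding.EndpointExistence D.C.toB12)) :
    D.ym4_torus_continuum_limit_exists' ∧ D.ym4_torus_continuum_limit_unique' ∧
      D.limit_reflectionPositive' ∧ D.limit_torusCovariant' :=
  printed_targets'_of_summableUnder' h (summableUnder_of_canonicalSummableCovUnder D h.avgMeasurable _ hR)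

/-- (0.4)-data: the canonical summable supplier-currency data under the prefix ⇒ all four targets. [folklore] -/
theorem targets_of_canonicalSummableCovUnder (h : D.IsBlockAveraged ℰ) (hE : ℰ.MeasurableE)
    (hR : CanonicalSummableCovUnder D (avgLevelHomogeneous_of_isBlockAveraged h) (BetaPertHyp D.βfun)) :
    D.ym4_torus_continuum_limit_exists ∧ D.ym4_torus_continuum_limit_unique ∧
      D.limit_reflectionPositive ∧ D.limit_torusCovariant :=
  targets_of_summableUnder h hE (summableUnder_of_canonicalSummableCovUnder D (h.avgMeasurable hE) _ hR)

/-- Two-level data: the canonical summable supplier-currency data under the prefix ⇒ all four targets. [folklore] -/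
theorem targets₂_of_canonicalSummableCovUnder (h : D.IsBlockAveraged₂ 𝓜 ℰ) (hM : 𝓜.MeasurableM) (hE : ℰ.MeasurableE)
    (hR : CanonicalSummableCovUnder D (avgLevelHomogeneous_of_isBlockAveraged₂ h) (BetaPertHyp D.βfun)) :
    D.ym4_torus_continuum_limit_exists ∧ D.ym4_torus_continuum_limit_unique ∧
      D.limit_reflectionPositive ∧ D.limit_torusCovariant :=
  targets₂_of_summableUnder h hM hE (summableUnder_of_canonicalSummableCovUnder D (h.avgMeasurable hM hE) _ hR)

end SU

section Headline

variable {N : ℕ} [NeZero N]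

/-- **`T4Apex.YM4TorusContinuumPrintedSU N` FROM THE LANE'S WEAKEST DATA FOR ALL PRINTED-AVERAGED DATA**: CONDITIONAL; the
antecedent (a summable envelope of the one-run defects and mid-level limits at every fixed distance along every tuned scheme, under
(B) and the β-hypothesis) is a located new estimate, not in print. [folklore] -/
theorem printedSU_of_summableUnder
    (h : ∀ (F : T4Family) (D : FiniteEpsData F (Matrix.specialUnitaryGroup (Fin N) ℂ)), D.IsPrintedAveraged →
      SummableUnder D (BetaPertHyp D.βfun)) :
    T4Apex.YM4TorusContinuumPrintedSU N :=
  fun F D hD => printed_targets_of_summableUnder hD (h F D hD)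

/-- Print-faithful form (`T4Apex.YM4TorusContinuumPrintedSU' N`). [folklore] -/
theorem printedSU'_of_summableUnder'
    (h : ∀ (F : T4Family) (D : FiniteEpsData F (Matrix.specialUnitaryGroup (Fin N) ℂ)), D.IsPrintedAveraged →
      SummableUnder D (DagBinding.EndpointExistence D.C.toB12)) :
    T4Apex.YM4TorusContinuumPrintedSU' N :=
  fun F D hD => printed_targets'_of_summableUnder' hD (h F D hD)

/-- **`T4Apex.YM4TorusContinuumBlockSU N` FROM THE LANE'S WEAKEST DATA FOR ALL (0.4)-DATA.** [folklore] -/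
theorem blockSU_of_summableUnder
    (h : ∀ (F : T4Family) (ℰ : LoopAverage (Matrix.specialUnitaryGroup (Fin N) ℂ)), ℰ.MeasurableE →
      ∀ D : FiniteEpsData F (Matrix.specialUnitaryGroup (Fin N) ℂ), D.IsBlockAveraged ℰ → SummableUnder D (BetaPertHyp D.βfun)) :
    T4Apex.YM4TorusContinuumBlockSU N :=
  fun F ℰ hE D hD => targets_of_summableUnder hD hE (h F ℰ hE D hD)

/-- **`T4Apex.YM4TorusContinuumPrintedSU N` FROM THE CANONICAL SUMMABLE SUPPLIER-CURRENCY DATA FOR ALL PRINTED-AVERAGED DATA**: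
CONDITIONAL; the antecedent (summable exterior-covariance step budgets, an injected rate, normalised level laws with a good/bad
density datum along the kernel's relocation `ladderShift`, under (B) and the β-hypothesis) is a located new estimate, not in print,
and is a statement about the data alone.  The bond-decidability instance is supplied classically. [folklore] -/
theorem printedSU_of_canonicalSummableCovUnder
    (h : ∀ (F : T4Family) [∀ K j : ℕ, DecidableEq (PBond (F.P K) j)] (D : FiniteEpsData F (Matrix.specialUnitaryGroup (Fin N) ℂ))
      (hP : D.IsPrintedAveraged), CanonicalSummableCovUnder D (avgLevelHomogeneous_of_printed hP) (BetaPertHyp D.βfun)) :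
    T4Apex.YM4TorusContinuumPrintedSU N := by
  intro F D hD
  classical
  exact printed_targets_of_canonicalSummableCovUnder hD (h F D hD)

/-- Print-faithful form. [folklore] -/
theorem printedSU'_of_canonicalSummableCovUnder'
    (h : ∀ (F : T4Family) [∀ K j : ℕ, DecidableEq (PBond (F.P K) j)] (D : FiniteEpsData F (Matrix.specialUnitaryGroup (Fin N) ℂ))
      (hP : D.IsPrintedAveraged),
      CanonicalSummableCovUnder D (avgLevelHomogeneous_of_printed hP) (DagBinding.EndpointExistence D.C.toB12)) :
    T4Apex.YM4TorusContinuumPrintedSU' N := by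
  intro F D hD
  classical
  exact printed_targets'_of_canonicalSummableCovUnder' hD (h F D hD)

/-- **`T4Apex.YM4TorusContinuumBlockSU N` FROM THE CANONICAL SUMMABLE SUPPLIER-CURRENCY DATA FOR ALL (0.4)-DATA.** [folklore] -/
theorem blockSU_of_canonicalSummableCovUnder
    (h : ∀ (F : T4Family) [∀ K j : ℕ, DecidableEq (PBond (F.P K) j)] (ℰ : LoopAverage (Matrix.specialUnitaryGroup (Fin N) ℂ)),
      ℰ.MeasurableE → ∀ (D : FiniteEpsData F (Matrix.specialUnitaryGroup (Fin N) ℂ)) (hB : D.IsBlockAveraged ℰ),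
        CanonicalSummableCovUnder D (avgLevelHomogeneous_of_isBlockAveraged hB) (BetaPertHyp D.βfun)) :
    T4Apex.YM4TorusContinuumBlockSU N := by
  intro F ℰ hE D hD
  classical
  exact targets_of_canonicalSummableCovUnder hD hE (h F ℰ hE D hD)

/-- **INHABITED AND VACUOUS, BY NAME**: on `SU(N)` every lattice family carries a printed-averaged datum — the labelled placeholder
of `T4Apex.exists_isPrintedAveraged₁_not_endStatementBPrinted`, at which (B) FAILS — satisfying `SummableUnder D Hβ` and
`CanonicalSummableCovUnder D _ Hβ` for every `Hβ`.  Such instances carry no content; the content lies in printed-averaged data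
satisfying (B), constructed nowhere in the tree. [folklore] -/
theorem exists_isPrintedAveraged_summable_vacuous (F : T4Family) [∀ K j : ℕ, DecidableEq (PBond (F.P K) j)] (Hβ : Prop) :
    ∃ (D : FiniteEpsData F (Matrix.specialUnitaryGroup (Fin N) ℂ)) (hP : D.IsPrintedAveraged), ¬ B16.EndStatementBPrinted D.C ∧
      SummableUnder D Hβ ∧ CanonicalSummableCovUnder D (avgLevelHomogeneous_of_printed hP) Hβ := by
  obtain ⟨D, h₁, hB⟩ := T4Apex.exists_isPrintedAveraged₁_not_endStatementBPrinted (N := N) F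
  exact ⟨D, h₁.isPrintedAveraged, hB, summableUnder_of_not_endStatementBPrinted D hB Hβ,
    canonicalSummableCovUnder_of_not_endStatementBPrinted D _ hB Hβ⟩

end Headline

/-! ## §5 The series form of the continuum expectation and the located strictness of the lane's wall (real analysis)

Everything below is elementary analysis of the cell's real-number sequences `K ↦ (D.scheme g₀).expectAt K Cs`,
`K ↦ finalExpect D g₀ K Cs`, `K ↦ midExpect D g₀ K Cs m`, `K ↦ normDefect D g₀ K Cs n` on the telescoping identities of
`T4ObservableTelescopeTwoRun` (`expectAt_eq_finalExpect_add_sum`, `midExpect_eq_finalExpect_add_sum`); the only external input is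
Tannery's theorem (Mathlib `tendsto_tsum_of_dominated_convergence`).  Two book-keeping names are introduced (`FinalLimits`,
`DefectLimits`), both CONSEQUENCES of the upstream shape `MidLimits` and jointly equivalent to it; nothing is asserted of any datum. -/

section Series

variable {F : T4Family} {G : Type*} [GaugeGroup G] [MeasurableSpace G] [HaarData G]

/-- CONSECUTIVE MID-LEVEL EXPECTATIONS DIFFER BY ONE NORMALISED DEFECT: `mid_K(m+1) − mid_K(m) = normDefect_K(m)` for `m + 1 ≤ K`
(`midExpect_eq_finalExpect_add_sum` at `m` and `m + 1`). [folklore] -/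
theorem midExpect_succ_sub [RegularGaugeGroup G] (D : FiniteEpsData F G) (hM : D.AvgMeasurable) (g₀ : ℕ → ℝ)
    (Cs : List (ULoop F)) {K m : ℕ} (hm : m + 1 ≤ K) :
    midExpect D g₀ K Cs (m + 1) - midExpect D g₀ K Cs m = normDefect D g₀ K Cs m := by
  rw [midExpect_eq_finalExpect_add_sum D hM g₀ Cs hm, midExpect_eq_finalExpect_add_sum D hM g₀ Cs (Nat.le_of_succ_le hm),
    Finset.sum_range_succ]
  ring

/-- BOOK-KEEPING NAME (NOT PRINTED, never asserted) — **FINAL-DENSITY LIMITS**: per string, the final-density expectations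
`K ↦ finalExpect D g₀ K Cs` (the plain loop product against run `K`'s LAST density on the unit lattice, normalised) converge as
`K → ∞`.  `= MidLimits` at distance `0` (`midExpect_zero`).  Cell reading: the undressed node-U5 statement at the END of the runs —
the `ε → 0` convergence of the final effective densities seen by one bounded unit-lattice functional. [folklore] -/
def FinalLimits (D : FiniteEpsData F G) (g₀ : ℕ → ℝ) : Prop :=
  ∀ Cs : List (ULoop F), ∃ ℓ : ℝ, Tendsto (fun K => finalExpect D g₀ K Cs) atTop (𝓝 ℓ)

/-- BOOK-KEEPING NAME (NOT PRINTED, never asserted) — **PER-DISTANCE DEFECT LIMITS**: per string and per FIXED scale distance `n`,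
the normalised one-step defects `K ↦ normDefect D g₀ K Cs n` (one ℝ-step of run `K`, the `n`-th from its end, against the loop
product pulled back `n` levels) converge as `K → ∞`.  A ONE-STEP, FIXED-PHYSICAL-SCALE statement: the step at distance `n` from the
end acts at the same physical scale in every run.  Implied by `MidLimits` (differences at distances `n + 1` and `n`). [folklore] -/
def DefectLimits (D : FiniteEpsData F G) (g₀ : ℕ → ℝ) : Prop :=
  ∀ (Cs : List (ULoop F)) (n : ℕ), ∃ d : ℝ, Tendsto (fun K => normDefect D g₀ K Cs n) atTop (𝓝 d)

/-- `MidLimits ⇒ FinalLimits` (distance `0`). [folklore] -/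
theorem finalLimits_of_midLimits (D : FiniteEpsData F G) (g₀ : ℕ → ℝ) (h : MidLimits D g₀) : FinalLimits D g₀ := by
  intro Cs
  obtain ⟨ℓ, hℓ⟩ := h Cs 0
  exact ⟨ℓ, by simpa only [midExpect_zero] using hℓ⟩

/-- `MidLimits ⇒ DefectLimits` (`normDefect_K(n) = mid_K(n+1) − mid_K(n)` for `K ≥ n + 1`). [folklore] -/
theorem defectLimits_of_midLimits [RegularGaugeGroup G] (D : FiniteEpsData F G) (hM : D.AvgMeasurable) (g₀ : ℕ → ℝ)
    (h : MidLimits D g₀) : DefectLimits D g₀ := by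
  intro Cs n
  obtain ⟨ℓ₁, h₁⟩ := h Cs (n + 1)
  obtain ⟨ℓ₀, h₀⟩ := h Cs n
  refine ⟨ℓ₁ - ℓ₀, (h₁.sub h₀).congr' ?_⟩
  filter_upwards [eventually_ge_atTop (n + 1)] with K hK
  exact midExpect_succ_sub D hM g₀ Cs hK

/-- `FinalLimits ∧ DefectLimits ⇒ MidLimits` (induction on the distance: `mid_K(m+1) = mid_K(m) + normDefect_K(m)`). [folklore] -/
theorem midLimits_of_final_defect [RegularGaugeGroup G] (D : FiniteEpsData F G) (hM : D.AvgMeasurable) (g₀ : ℕ → ℝ)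
    (hF : FinalLimits D g₀) (hD : DefectLimits D g₀) : MidLimits D g₀ := by
  intro Cs m
  induction m with
  | zero =>
      obtain ⟨ℓ, hℓ⟩ := hF Cs
      exact ⟨ℓ, by simpa only [midExpect_zero] using hℓ⟩
  | succ m ih =>
      obtain ⟨ℓ, hℓ⟩ := ih
      obtain ⟨d, hd⟩ := hD Cs m
      refine ⟨ℓ + d, (hℓ.add hd).congr' ?_⟩
      filter_upwards [eventually_ge_atTop (m + 1)] with K hK
      rw [← midExpect_succ_sub D hM g₀ Cs hK]
      ring

/-- **THE TWO-RUN HALF OF THE WALL, SPLIT: `MidLimits ⇔ FinalLimits ∧ DefectLimits`.** [folklore] -/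
theorem midLimits_iff_final_defect [RegularGaugeGroup G] (D : FiniteEpsData F G) (hM : D.AvgMeasurable) (g₀ : ℕ → ℝ) :
    MidLimits D g₀ ↔ FinalLimits D g₀ ∧ DefectLimits D g₀ :=
  ⟨fun h => ⟨finalLimits_of_midLimits D g₀ h, defectLimits_of_midLimits D hM g₀ h⟩,
    fun h => midLimits_of_final_defect D hM g₀ h.1 h.2⟩

/-- `FinalMatching ⇒ FinalLimits` (summable consecutive differences ⇒ convergence; `T4SummableDefect.exists_tendsto_of_dist_le_from`
at distance `0`): the first component of the two-run bundle `TwoRunTelescopeData` in the new names. [folklore] -/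
theorem finalLimits_of_finalMatching (D : FiniteEpsData F G) (g₀ : ℕ → ℝ) (h : FinalMatching D g₀) : FinalLimits D g₀ := by
  intro Cs
  obtain ⟨b, hb, hK⟩ := h Cs
  exact exists_tendsto_of_dist_le_from (f := fun K => finalExpect D g₀ K Cs) 0 hb fun K _ => by simpa using hK K

/-- RUN `K`'S DEFECT ROW EXTENDED BY ZERO beyond its length: `normDefect_K(n)` for `n < K`, `0` otherwise (so that the near-defect
sum of `expectAt_eq_finalExpect_add_sum` is a `tsum` over all distances and Tannery's theorem applies). [folklore] -/
def truncDefect (D : FiniteEpsData F G) (g₀ : ℕ → ℝ) (Cs : List (ULoop F)) (K n : ℕ) : ℝ :=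
  if n < K then normDefect D g₀ K Cs n else 0

/-- `⟨∏⟩_K = finalExpect_K + Σ'_n truncDefect_K(n)`. [folklore] -/
theorem expectAt_eq_finalExpect_add_tsum [RegularGaugeGroup G] (D : FiniteEpsData F G) (hM : D.AvgMeasurable) (g₀ : ℕ → ℝ)
    (K : ℕ) (Cs : List (ULoop F)) :
    (D.scheme g₀).expectAt K Cs = finalExpect D g₀ K Cs + ∑' n, truncDefect D g₀ Cs K n := by
  rw [expectAt_eq_finalExpect_add_sum D hM g₀ K Cs,
    tsum_eq_sum (s := Finset.range K) (fun n hn => by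
      have h : ¬ n < K := fun h => hn (Finset.mem_range.mpr h)
      simp [truncDefect, h])]
  congr 1
  exact Finset.sum_congr rfl fun n hn => by simp [truncDefect, Finset.mem_range.mp hn]

/-- The extended defect row is dominated by the envelope: `|truncDefect_K(n)| ≤ A n`. [folklore] -/
theorem abs_truncDefect_le (D : FiniteEpsData F G) (g₀ : ℕ → ℝ) (Cs : List (ULoop F)) {A : ℕ → ℝ} (hA0 : ∀ n, 0 ≤ A n)
    (hK : ∀ K n, n < K → |normDefect D g₀ K Cs n| ≤ A n) (K n : ℕ) : |truncDefect D g₀ Cs K n| ≤ A n := by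
  unfold truncDefect
  split_ifs with h
  · exact hK K n h
  · simpa using hA0 n

/-- At a fixed distance the extended row is eventually the defect itself, so it has the same limit. [folklore] -/
theorem tendsto_truncDefect (D : FiniteEpsData F G) (g₀ : ℕ → ℝ) (Cs : List (ULoop F)) {n : ℕ} {d : ℝ}
    (hd : Tendsto (fun K => normDefect D g₀ K Cs n) atTop (𝓝 d)) : Tendsto (fun K => truncDefect D g₀ Cs K n) atTop (𝓝 d) := by
  refine hd.congr' ?_
  filter_upwards [eventually_gt_atTop n] with K hK
  simp [truncDefect, hK]

/-- **TANNERY FOR THE NEAR-DEFECT SUMS**: under a summable envelope and per-distance defect limits `d n`, the near-defect sums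
`Σ_{n<K} normDefect_K(n)` converge to the absolutely convergent series `Σ'_n d n`. [folklore] -/
theorem tendsto_sum_normDefect [RegularGaugeGroup G] (D : FiniteEpsData F G) (g₀ : ℕ → ℝ) (Cs : List (ULoop F)) {A : ℕ → ℝ}
    (hA0 : ∀ n, 0 ≤ A n) (hA : Summable A) (hK : ∀ K n, n < K → |normDefect D g₀ K Cs n| ≤ A n) {d : ℕ → ℝ}
    (hd : ∀ n, Tendsto (fun K => normDefect D g₀ K Cs n) atTop (𝓝 (d n))) :
    Tendsto (fun K => ∑' n, truncDefect D g₀ Cs K n) atTop (𝓝 (∑' n, d n)) :=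
  tendsto_tsum_of_dominated_convergence hA (fun n => tendsto_truncDefect D g₀ Cs (hd n))
    (Eventually.of_forall fun K n => by
      rw [Real.norm_eq_abs]
      exact abs_truncDefect_le D g₀ Cs hA0 hK K n)

/-- The defect limits are dominated by the envelope, `|d n| ≤ A n`, hence absolutely summable. [folklore] -/
theorem abs_defectLim_le (D : FiniteEpsData F G) (g₀ : ℕ → ℝ) (Cs : List (ULoop F)) {A : ℕ → ℝ}
    (hK : ∀ K n, n < K → |normDefect D g₀ K Cs n| ≤ A n) {n : ℕ} {d : ℝ}
    (hd : Tendsto (fun K => normDefect D g₀ K Cs n) atTop (𝓝 d)) : |d| ≤ A n := by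
  refine le_of_tendsto hd.abs ?_
  filter_upwards [eventually_gt_atTop n] with K hKn
  exact hK K n hKn

/-- [folklore] -/
theorem summable_defectLim (D : FiniteEpsData F G) (g₀ : ℕ → ℝ) (Cs : List (ULoop F)) {A : ℕ → ℝ} (hA : Summable A)
    (hK : ∀ K n, n < K → |normDefect D g₀ K Cs n| ≤ A n) {d : ℕ → ℝ}
    (hd : ∀ n, Tendsto (fun K => normDefect D g₀ K Cs n) atTop (𝓝 (d n))) : Summable d :=
  hA.of_norm_bounded fun n => by
    rw [Real.norm_eq_abs]
    exact abs_defectLim_le D g₀ Cs hK (hd n)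

/-- **THE SERIES FORM OF THE CONTINUUM EXPECTATION**: under a summable envelope of the one-run defects, if the final-density
expectations converge to `ℓ` and the defect at each fixed distance `n` converges to `d n`, then the expectations converge to
`ℓ + Σ'_n d n` — the continuum expectation of the string IS the final-density limit plus the absolutely convergent series of
per-step defect limits (`expectAt_eq_finalExpect_add_tsum` + Tannery). [folklore] -/
theorem tendsto_expectAt_series [RegularGaugeGroup G] (D : FiniteEpsData F G) (hM : D.AvgMeasurable) (g₀ : ℕ → ℝ)
    (Cs : List (ULoop F)) {A : ℕ → ℝ} (hA0 : ∀ n, 0 ≤ A n) (hA : Summable A)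
    (hK : ∀ K n, n < K → |normDefect D g₀ K Cs n| ≤ A n) {ℓ : ℝ}
    (hℓ : Tendsto (fun K => finalExpect D g₀ K Cs) atTop (𝓝 ℓ)) {d : ℕ → ℝ}
    (hd : ∀ n, Tendsto (fun K => normDefect D g₀ K Cs n) atTop (𝓝 (d n))) :
    Tendsto (fun K => (D.scheme g₀).expectAt K Cs) atTop (𝓝 (ℓ + ∑' n, d n)) := by
  refine (hℓ.add (tendsto_sum_normDefect D g₀ Cs hA0 hA hK hd)).congr' (Eventually.of_forall fun K => ?_)
  exact (expectAt_eq_finalExpect_add_tsum D hM g₀ K Cs).symm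

/-- **… AND CONVERSELY, THE FINAL-DENSITY EXPECTATIONS CONVERGE IF THE EXPECTATIONS DO**: under the envelope and per-distance
defect limits, `⟨∏⟩_K → l` forces `finalExpect_K → l − Σ'_n d n`. [folklore] -/
theorem tendsto_finalExpect_of_tendsto_expectAt [RegularGaugeGroup G] (D : FiniteEpsData F G) (hM : D.AvgMeasurable)
    (g₀ : ℕ → ℝ) (Cs : List (ULoop F)) {A : ℕ → ℝ} (hA0 : ∀ n, 0 ≤ A n) (hA : Summable A)
    (hK : ∀ K n, n < K → |normDefect D g₀ K Cs n| ≤ A n) {l : ℝ}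
    (hl : Tendsto (fun K => (D.scheme g₀).expectAt K Cs) atTop (𝓝 l)) {d : ℕ → ℝ}
    (hd : ∀ n, Tendsto (fun K => normDefect D g₀ K Cs n) atTop (𝓝 (d n))) :
    Tendsto (fun K => finalExpect D g₀ K Cs) atTop (𝓝 (l - ∑' n, d n)) := by
  refine (hl.sub (tendsto_sum_normDefect D g₀ Cs hA0 hA hK hd)).congr' (Eventually.of_forall fun K => ?_)
  rw [expectAt_eq_finalExpect_add_tsum D hM g₀ K Cs, add_sub_cancel_right]

/-- **EXISTENCE FROM THE SPLIT DATA** (`UniformSummableDefect ∧ FinalLimits ∧ DefectLimits ⇒ HasContinuumLimit`; through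
`midLimits_of_final_defect` and the generation-8 theorem, or directly by the series form). [folklore] -/
theorem hasContinuumLimit_of_summableDefect_final_defect [RegularGaugeGroup G] (D : FiniteEpsData F G) (hM : D.AvgMeasurable)
    (g₀ : ℕ → ℝ) (hU : UniformSummableDefect D g₀) (hF : FinalLimits D g₀) (hD : DefectLimits D g₀) :
    HasContinuumLimit (D.scheme g₀) :=
  hasContinuumLimit_of_summableDefect_midLimits D hM g₀ hU (midLimits_of_final_defect D hM g₀ hF hD)

/-- **NECESSITY OF THE FINAL-DENSITY LIMITS**: given the envelope (W1∞) and the per-distance defect limits, existence of the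
continuum limit FORCES `FinalLimits` (hence `MidLimits`, hence the whole two-run half (W2′) of the wall). [folklore] -/
theorem finalLimits_of_hasContinuumLimit [RegularGaugeGroup G] (D : FiniteEpsData F G) (hM : D.AvgMeasurable) (g₀ : ℕ → ℝ)
    (hU : UniformSummableDefect D g₀) (hD : DefectLimits D g₀) (h : HasContinuumLimit (D.scheme g₀)) : FinalLimits D g₀ := by
  intro Cs
  obtain ⟨A, hA0, hA, hK⟩ := hU Cs
  obtain ⟨l, hl⟩ := h Cs
  choose d hd using hD Cs
  exact ⟨_, tendsto_finalExpect_of_tendsto_expectAt D hM g₀ Cs hA0 hA hK hl hd⟩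

/-- **LOCATED STRICTNESS OF THE LANE'S WALL**: given `UniformSummableDefect D g₀` (W1∞) and `DefectLimits D g₀`, the target
`HasContinuumLimit (D.scheme g₀)` is EQUIVALENT to `FinalLimits D g₀` … [folklore] -/
theorem hasContinuumLimit_iff_finalLimits [RegularGaugeGroup G] (D : FiniteEpsData F G) (hM : D.AvgMeasurable) (g₀ : ℕ → ℝ)
    (hU : UniformSummableDefect D g₀) (hD : DefectLimits D g₀) : HasContinuumLimit (D.scheme g₀) ↔ FinalLimits D g₀ :=
  ⟨finalLimits_of_hasContinuumLimit D hM g₀ hU hD, fun hF => hasContinuumLimit_of_summableDefect_final_defect D hM g₀ hU hF hD⟩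

/-- … equivalently to `MidLimits D g₀` (W2′) … [folklore] -/
theorem hasContinuumLimit_iff_midLimits [RegularGaugeGroup G] (D : FiniteEpsData F G) (hM : D.AvgMeasurable) (g₀ : ℕ → ℝ)
    (hU : UniformSummableDefect D g₀) (hD : DefectLimits D g₀) : HasContinuumLimit (D.scheme g₀) ↔ MidLimits D g₀ := by
  rw [hasContinuumLimit_iff_finalLimits D hM g₀ hU hD, midLimits_iff_final_defect D hM g₀]
  exact ⟨fun hF => ⟨hF, hD⟩, fun h => h.1⟩

/-- … equivalently to the lane's weakest bundle `SummableTelescopeData D g₀`: the sufficient condition (W1∞) ∧ (W2′) exceeds the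
target by at most (W1∞) ∧ `DefectLimits`.  No converse for (W1∞) or `DefectLimits` is claimed. [folklore] -/
theorem hasContinuumLimit_iff_summableTelescopeData [RegularGaugeGroup G] (D : FiniteEpsData F G) (hM : D.AvgMeasurable)
    (g₀ : ℕ → ℝ) (hU : UniformSummableDefect D g₀) (hD : DefectLimits D g₀) :
    HasContinuumLimit (D.scheme g₀) ↔ SummableTelescopeData D g₀ := by
  rw [hasContinuumLimit_iff_midLimits D hM g₀ hU hD]
  exact ⟨fun h => ⟨hU, h⟩, fun h => h.2⟩

/-- **THE LIMIT FUNCTIONAL IN SERIES FORM**: under (W1∞), `FinalLimits` and `DefectLimits`, a limit functional exists and EVERY limit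
functional `E` satisfies `E Cs = ℓ(Cs) + Σ'_n d_n(Cs)` for the final-density limit `ℓ(Cs)` and the defect limits `d_n(Cs)` of the
string (limits in `ℝ` are unique). [folklore] -/
theorem isLimitFunctional_series [RegularGaugeGroup G] (D : FiniteEpsData F G) (hM : D.AvgMeasurable) (g₀ : ℕ → ℝ)
    {E : List (ULoop F) → ℝ} (hE : IsLimitFunctional (D.scheme g₀).expectAt E) (Cs : List (ULoop F)) {A : ℕ → ℝ}
    (hA0 : ∀ n, 0 ≤ A n) (hA : Summable A) (hK : ∀ K n, n < K → |normDefect D g₀ K Cs n| ≤ A n) {ℓ : ℝ}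
    (hℓ : Tendsto (fun K => finalExpect D g₀ K Cs) atTop (𝓝 ℓ)) {d : ℕ → ℝ}
    (hd : ∀ n, Tendsto (fun K => normDefect D g₀ K Cs n) atTop (𝓝 (d n))) : E Cs = ℓ + ∑' n, d n :=
  tendsto_nhds_unique (hE Cs) (tendsto_expectAt_series D hM g₀ Cs hA0 hA hK hℓ hd)

end Series

/-! ### §5b The same under the targets' prefix -/

section SeriesPrefix

variable {F : T4Family} {G : Type*} [GaugeGroup G] [MeasurableSpace G] [HaarData G]

/-- CONJUNCTION UNDER THE PREFIX: two conclusions holding under the prefix (each with its own thresholds `γ₀`, `g₁`) hold jointly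
under it (the smaller thresholds). Bookkeeping on `FiniteEpsData.UnderHypotheses`. [folklore] -/
theorem underHypotheses_and {D : FiniteEpsData F G} {Hβ : Prop} {c₁ c₂ : (ℕ → ℝ) → Prop} (h₁ : D.UnderHypotheses Hβ c₁)
    (h₂ : D.UnderHypotheses Hβ c₂) : D.UnderHypotheses Hβ fun g₀ => c₁ g₀ ∧ c₂ g₀ := by
  intro hB hβ
  obtain ⟨γ₁, hγ₁, K₁⟩ := h₁ hB hβ
  obtain ⟨γ₂, hγ₂, K₂⟩ := h₂ hB hβ
  refine ⟨min γ₁ γ₂, lt_min hγ₁ hγ₂, fun γ hγ hγle => ?_⟩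
  obtain ⟨a₁, ha₁, L₁⟩ := K₁ γ hγ (hγle.trans (min_le_left _ _))
  obtain ⟨a₂, ha₂, L₂⟩ := K₂ γ hγ (hγle.trans (min_le_right _ _))
  exact ⟨min a₁ a₂, lt_min ha₁ ha₂, fun g hg hgle g₀ ht =>
    ⟨L₁ g hg (hgle.trans (min_le_left _ _)) g₀ ht, L₂ g hg (hgle.trans (min_le_right _ _)) g₀ ht⟩⟩

/-- BOOK-KEEPING NAME — **FINAL-DENSITY LIMITS UNDER THE PREFIX**: along every tuned scheme, `FinalLimits D g₀`.  NOT PRINTED;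
never asserted. [folklore] -/
def FinalLimitsUnder (D : FiniteEpsData F G) (Hβ : Prop) : Prop :=
  D.UnderHypotheses Hβ fun g₀ => FinalLimits D g₀

/-- BOOK-KEEPING NAME — **THE ENVELOPE AND THE PER-DISTANCE DEFECT LIMITS UNDER THE PREFIX**: along every tuned scheme,
`UniformSummableDefect D g₀ ∧ DefectLimits D g₀` (the part of the wall for which no converse is available).  NOT PRINTED;
never asserted. [folklore] -/
def EnvelopeDefectLimitsUnder (D : FiniteEpsData F G) (Hβ : Prop) : Prop :=
  D.UnderHypotheses Hβ fun g₀ => UniformSummableDefect D g₀ ∧ DefectLimits D g₀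

/-- `SummableUnder ⇒ FinalLimitsUnder` and `⇒ EnvelopeDefectLimitsUnder` (the split of §5, under the prefix). [folklore] -/
theorem finalLimitsUnder_of_summableUnder (D : FiniteEpsData F G) {Hβ : Prop} (h : SummableUnder D Hβ) :
    FinalLimitsUnder D Hβ :=
  FiniteEpsData.UnderHypotheses.mono (fun g₀ hg => finalLimits_of_midLimits D g₀ hg.2) h

/-- [folklore] -/
theorem envelopeDefectLimitsUnder_of_summableUnder [RegularGaugeGroup G] (D : FiniteEpsData F G) (hM : D.AvgMeasurable)
    {Hβ : Prop} (h : SummableUnder D Hβ) : EnvelopeDefectLimitsUnder D Hβ :=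
  FiniteEpsData.UnderHypotheses.mono (fun g₀ hg => ⟨hg.1, defectLimits_of_midLimits D hM g₀ hg.2⟩) h

/-- … and back: `EnvelopeDefectLimitsUnder ∧ FinalLimitsUnder ⇒ SummableUnder`. [folklore] -/
theorem summableUnder_of_envelope_final [RegularGaugeGroup G] (D : FiniteEpsData F G) (hM : D.AvgMeasurable) {Hβ : Prop}
    (h₁ : EnvelopeDefectLimitsUnder D Hβ) (h₂ : FinalLimitsUnder D Hβ) : SummableUnder D Hβ :=
  FiniteEpsData.UnderHypotheses.mono (fun g₀ hg => ⟨hg.1.1, midLimits_of_final_defect D hM g₀ hg.2 hg.1.2⟩)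
    (underHypotheses_and h₁ h₂)

/-- **LOCATED STRICTNESS UNDER THE PREFIX**: for data with measurable averaging maps and any `Hβ`, GIVEN `EnvelopeDefectLimitsUnder D Hβ`,
a limit functional exists under the prefix IFF `FinalLimitsUnder D Hβ` IFF `SummableUnder D Hβ`. [folklore] -/
theorem underHypotheses_exists_iff_finalLimitsUnder [RegularGaugeGroup G] (D : FiniteEpsData F G) (hM : D.AvgMeasurable)
    {Hβ : Prop} (h : EnvelopeDefectLimitsUnder D Hβ) :
    (D.UnderHypotheses Hβ fun g₀ => ∃ E : List (ULoop F) → ℝ, IsLimitFunctional (D.scheme g₀).expectAt E) ↔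
      FinalLimitsUnder D Hβ := by
  constructor
  · intro hE
    exact FiniteEpsData.UnderHypotheses.mono (fun g₀ hg => finalLimits_of_hasContinuumLimit D hM g₀ hg.1.1 hg.1.2
      ((hasContinuumLimit_iff_exists_isLimitFunctional (D.scheme g₀)).mpr hg.2)) (underHypotheses_and h hE)
  · intro hF
    exact underHypotheses_exists_of_summableUnder D hM (summableUnder_of_envelope_final D hM h hF)

/-- [folklore] -/
theorem summableUnder_iff_finalLimitsUnder [RegularGaugeGroup G] (D : FiniteEpsData F G) (hM : D.AvgMeasurable) {Hβ : Prop}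
    (h : EnvelopeDefectLimitsUnder D Hβ) : SummableUnder D Hβ ↔ FinalLimitsUnder D Hβ :=
  ⟨finalLimitsUnder_of_summableUnder D, summableUnder_of_envelope_final D hM h⟩

/-- **THE EXISTENCE TARGET ⇔ `FinalLimitsUnder D (BetaPertHyp D.βfun)`, GIVEN `EnvelopeDefectLimitsUnder D (BetaPertHyp D.βfun)`.**
(Scoping note's hypothesis form.) [folklore] -/
theorem limit_exists_iff_finalLimitsUnder [RegularGaugeGroup G] (D : FiniteEpsData F G) (hM : D.AvgMeasurable)
    (h : EnvelopeDefectLimitsUnder D (BetaPertHyp D.βfun)) :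
    D.ym4_torus_continuum_limit_exists ↔ FinalLimitsUnder D (BetaPertHyp D.βfun) :=
  underHypotheses_exists_iff_finalLimitsUnder D hM h

/-- Print-faithful form. [folklore] -/
theorem limit_exists'_iff_finalLimitsUnder' [RegularGaugeGroup G] (D : FiniteEpsData F G) (hM : D.AvgMeasurable)
    (h : EnvelopeDefectLimitsUnder D (DagBinding.EndpointExistence D.C.toB12)) :
    D.ym4_torus_continuum_limit_exists' ↔ FinalLimitsUnder D (DagBinding.EndpointExistence D.C.toB12) :=
  underHypotheses_exists_iff_finalLimitsUnder D hM h

/-- Vacuity at a datum violating (B), for the two book-keeping shapes. [folklore] -/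
theorem finalLimitsUnder_of_not_endStatementBPrinted (D : FiniteEpsData F G) (hB : ¬ B16.EndStatementBPrinted D.C) (Hβ : Prop) :
    FinalLimitsUnder D Hβ ∧ EnvelopeDefectLimitsUnder D Hβ :=
  ⟨fun h => absurd h hB, fun h => absurd h hB⟩

end SeriesPrefix

end T4ApexSummable

end Literature.MathematicalPhysics.QuantumFieldTheory.Balaban1983to89
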